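import Literature.Analysis.FluidPDE.NSSereginEnergyLine
import Literature.Analysis.FluidPDE.LocalLerayPressureBoundHolds
import Literature.Analysis.FluidPDE.CriticalRegularityScaling
import Literature.Analysis.FluidPDE.ForwardDSSLocalLeray
import HarnessLib

/-!
# Seregin's `L³` blow-up criterion for energy solutions: the inputs of the uniform initial layer
# (Seregin 2012, §2, (2.5)–(2.8)) for local energy solutions with `L³` data on short strips

Analysis/FluidPDE proof file (theorems only: no definition, no named fact, no `sorry`) on the
line of `Literature.Analysis.FluidPDE.seregin_L3_blowup` (**ns.S08**; Seregin 2012, Thm. 1.1),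
continuing `NSSereginEnergyLine.lean`, whose conditional theorem `seregin_L3_blowup_of_layer`
leaves one hypothesis: the uniform initial layer of local energy solutions with `L³` data on
short strips (Jia–Šverák 2013, Lemma 8 = Seregin 2012, (2.13), on a slab). The layer estimate is
a Grönwall argument on the local energy inequality of the caloric remainder whose *inputs* are
a priori bounds on parabolic cylinders `(0,T) × B(x₀, R)`: local energies, dissipation, and the
renormalised pressure (Seregin 2012, (2.6)–(2.8): "we may decompose the pressure in the same way
as it has been done in [KS] … `p^{(k)}_{x₀} ≡ p^{(k)} − c^{(k)}_{x₀}(t)`" with the bounds (2.7),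
(2.8); Jia–Šverák 2013, Cor. 1). This file supplies them for the slab class from the tree:

* `exists_cylinder_inputs_of_L3_data` — for `R > 0` there is `S₀(M) ∈ (0,1]` and, for every
  `0 < T ≤ S₀(M)`, a finite constant `E = E(M, T, R)` such that every local energy solution
  `(v, π)` with unit viscosity on `ℝ³ × (0, T)` whose datum `a ∈ L³` has `‖a‖₃ ≤ M` admits, about
  every centre `x₀`, a gauge `c ∈ L^{3/2}(0,T)` (measurable) for which `(v, π − c)` is again a local
  Leray solution on the slab and `∫_{B(x₀,R)} |v(t)|² ≤ E` (a.e. `t`),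
  `∫₀ᵀ∫_{B(x₀,R)} |∇v|² ≤ E`, `∫₀ᵀ∫_{B(x₀,R)} |π − c|^{3/2} ≤ E` (unit-ball bounds
  `exists_localEnergy_bounds_of_L3_data` + a finite cover, `Seregin2014Limit.exists_cover_const`;
  the gauge is Kang–Miura–Tsai's, `kangMiuraTsai_local_pressure_bound_holds`, Lemma 3.4 = (2.6)).

## References

* G. Seregin, Comm. Math. Phys. 312 (2012) 833–845 = arXiv:1104.3615, §2 (2.5)–(2.8).
  [Seregin2012CMP]
* H. Jia, V. Šverák, SIAM J. Math. Anal. 45 (2013) = arXiv:1201.1592, Cor. 1, Lemma 8.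
  [JiaSverak2013]
* K. Kang, H. Miura, T.-P. Tsai, IMRN 2021 = arXiv:1812.10509, Lemmas 3.4–3.5. [KangMiuraTsai2020]
-/

noncomputable section

open MeasureTheory TopologicalSpace Set Function Filter Metric
open _root_.Topology
open scoped ENNReal NNReal RealInnerProductSpace

namespace Literature.Analysis.FluidPDE

/-! ### A priori inputs on cylinders of radius `R` from unit-ball bounds -/

/-- **Inputs on `(0,T) × B(x₀,R)` from unit-ball bounds, with Kang–Miura–Tsai's pressure gauge**
(Seregin 2012, §2, (2.6)–(2.8): the decomposition `p_{x₀} = p − c_{x₀}(t) = p¹_{x₀} + p²_{x₀}` and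
its bounds; Kang–Miura–Tsai 2021, Lemmas 3.4–3.5; Jia–Šverák 2013, Cor. 1). Let `(v, π)` be a
local energy solution with unit viscosity on `ℝ³ × (0,T)` whose datum `a ∈ L³` has `‖a‖₃ ≤ M`,
with every-time unit-ball energies `≤ A` on `[0,T)` and unit-cylinder dissipation `≤ A` for every
weak spatial gradient. Then, with a constant `E = E(T, R, M, A)`: the dissipation on
`(0,T) × B(x₀,R)` is `≤ E` for every weak gradient and every `x₀` (finite cover,
`Seregin2014Limit.exists_cover_const`); the energies on `B(x₀,R)` are `≤ E` for a.e. `t`; and about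
every `x₀` there is a measurable gauge `c ∈ L^{3/2}(0,T)` such that `(v, π − c)` is again a local
Leray solution on the slab (`IsLocalLeraySolutionOn.sub_pressure`) with
`∫₀ᵀ∫_{B(x₀,R)} |π − c|^{3/2} ≤ E` (`kangMiuraTsai_local_pressure_bound_holds`, a measurable
modification of its gauge). [cite: Seregin2012CMP, §2 (2.6)–(2.8)] [cite: KangMiuraTsai2020, Lemmas 3.4–3.5] [cite: JiaSverak2013, Cor. 1] -/
theorem exists_cylinder_inputs_of_unitBall_bounds {T R : ℝ} (hT : 0 < T) (hR : 0 < R) (M A : ℝ≥0) :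
    ∃ E : ℝ≥0,
      ∀ (a : EuclideanSpace ℝ (Fin 3) → EuclideanSpace ℝ (Fin 3))
        (v : ℝ → EuclideanSpace ℝ (Fin 3) → EuclideanSpace ℝ (Fin 3))
        (π : ℝ → EuclideanSpace ℝ (Fin 3) → ℝ),
        MemLp a 3 volume → eLpNorm a 3 volume ≤ M → IsLocalEnergySolutionOn T 1 a v π →
        (∀ s ∈ Ico 0 T, ∀ y₀ : EuclideanSpace ℝ (Fin 3), ∫⁻ y in ball y₀ 1, ‖v s y‖ₑ ^ 2 ≤ A) →
        (∀ G : ℝ → EuclideanSpace ℝ (Fin 3) → EuclideanSpace ℝ (Fin 3) →L[ℝ] EuclideanSpace ℝ (Fin 3),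
          HasWeakSpatialGradientOn (slab (EuclideanSpace ℝ (Fin 3)) (Ioo 0 T) isOpen_Ioo) v G →
          ∀ y₀ : EuclideanSpace ℝ (Fin 3),
            ∫⁻ z in Ioo 0 T ×ˢ ball y₀ 1, ENNReal.ofReal (frobeniusNormSq (G z.1 z.2)) ≤ A) →
        (∀ G : ℝ → EuclideanSpace ℝ (Fin 3) → EuclideanSpace ℝ (Fin 3) →L[ℝ] EuclideanSpace ℝ (Fin 3),
          HasWeakSpatialGradientOn (slab (EuclideanSpace ℝ (Fin 3)) (Ioo 0 T) isOpen_Ioo) v G →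
          ∀ x₀ : EuclideanSpace ℝ (Fin 3),
            ∫⁻ z in Ioo 0 T ×ˢ ball x₀ R, ENNReal.ofReal (frobeniusNormSq (G z.1 z.2)) ≤ E) ∧
        ∀ x₀ : EuclideanSpace ℝ (Fin 3),
          (∀ᵐ t ∂(volume.restrict (Ioo 0 T)), ∫⁻ x in ball x₀ R, ‖v t x‖ₑ ^ 2 ≤ E) ∧
          ∃ c : ℝ → ℝ, Measurable c ∧ MemLp c (3 / 2 : ℝ≥0∞) (volume.restrict (Ioo 0 T)) ∧
            IsLocalLeraySolutionOn T 1 a v (fun t x => π t x - c t) ∧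
            ∫⁻ z in Ioo 0 T ×ˢ ball x₀ R, ‖π z.1 z.2 - c z.1‖ₑ ^ (3 / 2 : ℝ) ≤ E := by
  obtain ⟨N, hN₁, hN₂⟩ := Seregin2014Limit.exists_cover_const R
  -- Kang–Miura–Tsai's pressure bound for the data `(T, R, A')`, `A' = A + 2 M²`
  set A' : ℝ≥0 := A + 2 * M ^ 2 with hA'_def
  obtain ⟨K, hK⟩ := kangMiuraTsai_local_pressure_bound_holds T R A' hT hR
  refine ⟨N * A' + K + A', fun a v π ha haM hv hIco hGA => ?_⟩
  have hAA' : ((A : ℝ≥0) : ℝ≥0∞) ≤ A' := by exact_mod_cast le_self_add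
  -- the hypotheses of Kang–Miura–Tsai's bound with the constant `A'`
  have hαM : (eLpNorm a 3 volume).toNNReal ≤ M := by
    rw [← ENNReal.coe_le_coe, ENNReal.coe_toNNReal ha.eLpNorm_ne_top]
    exact haM
  have hdat : ∀ x₀ : EuclideanSpace ℝ (Fin 3), ∫⁻ x in ball x₀ 1, ‖a x‖ₑ ^ 2 ≤ A' := by
    intro x₀
    refine (lintegral_ball_enorm_sq_le_two_mul ha x₀ zero_le_one).trans ?_
    rw [hA'_def]
    push_cast
    rw [Real.toNNReal_one, ENNReal.coe_one, mul_one]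
    calc (2 : ℝ≥0∞) * ((eLpNorm a 3 volume).toNNReal : ℝ≥0∞) ^ 2 ≤ 2 * (M : ℝ≥0∞) ^ 2 := by
          gcongr
      _ ≤ (A : ℝ≥0∞) + 2 * (M : ℝ≥0∞) ^ 2 := le_add_self
  have hEA : ∀ᵐ t ∂(volume.restrict (Ioo 0 T)), ∀ x₀ : EuclideanSpace ℝ (Fin 3),
      ∫⁻ x in ball x₀ 1, ‖v t x‖ₑ ^ 2 ≤ A' :=
    (ae_restrict_mem measurableSet_Ioo).mono fun t ht x₀ => (hIco t ⟨ht.1.le, ht.2⟩ x₀).trans hAA'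
  obtain ⟨G₀, hG₀, -⟩ := hv.uniformLocalGradient
  have hGA' : ∃ G' : ℝ → EuclideanSpace ℝ (Fin 3) → EuclideanSpace ℝ (Fin 3) →L[ℝ] EuclideanSpace ℝ (Fin 3),
      HasWeakSpatialGradientOn (slab (EuclideanSpace ℝ (Fin 3)) (Ioo 0 T) isOpen_Ioo) v G' ∧
        ∀ x₀ : EuclideanSpace ℝ (Fin 3), ∫⁻ z in Ioo 0 T ×ˢ ball x₀ 1,
          ENNReal.ofReal (frobeniusNormSq (G' z.1 z.2)) ≤ A' :=
    ⟨G₀, hG₀, fun x₀ => (hGA G₀ hG₀ x₀).trans hAA'⟩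
  have hvL : IsLocalLeraySolutionOn T 1 a v π := hv.isLocalLeraySolutionOn
  have hKx := hK a v π hvL hdat (hv.isWeaklyDivFree_datum hT) hEA hGA'
  -- constants comparison
  have hNA : (N : ℝ≥0∞) * A' ≤ ((N * A' + K + A' : ℝ≥0) : ℝ≥0∞) := by
    push_cast
    calc (N : ℝ≥0∞) * A' ≤ (N : ℝ≥0∞) * A' + K := le_self_add
      _ ≤ (N : ℝ≥0∞) * A' + K + A' := le_self_add
  have hKle : (K : ℝ≥0∞) ≤ ((N * A' + K + A' : ℝ≥0) : ℝ≥0∞) := by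
    push_cast
    calc (K : ℝ≥0∞) ≤ (N : ℝ≥0∞) * A' + K := le_add_self
      _ ≤ (N : ℝ≥0∞) * A' + K + A' := le_self_add
  refine ⟨fun G' hG' x₀ => ?_, fun x₀ => ⟨?_, ?_⟩⟩
  · -- radius-`R` dissipation, for any weak gradient
    exact (hN₂ (fun z => ENNReal.ofReal (frobeniusNormSq (G' z.1 z.2))) (Ioo 0 T) A'
      (fun y => (hGA G' hG' y).trans hAA') x₀).trans hNA
  · -- radius-`R` energies, a.e. in time
    filter_upwards [hEA] with t ht
    exact (hN₁ (fun x => ‖v t x‖ₑ ^ 2) A' ht x₀).trans hNA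
  · -- the gauge about `x₀`: a measurable modification of Kang–Miura–Tsai's
    obtain ⟨c₀, hc₀L, hc₀b⟩ := hKx x₀
    set c : ℝ → ℝ := hc₀L.1.aemeasurable.mk c₀ with hc_def
    have hcm : Measurable c := hc₀L.1.aemeasurable.measurable_mk
    have hcc : c₀ =ᵐ[volume.restrict (Ioo 0 T)] c := hc₀L.1.aemeasurable.ae_eq_mk
    have hcL : MemLp c (3 / 2 : ℝ≥0∞) (volume.restrict (Ioo 0 T)) := hc₀L.ae_eq hcc
    -- on the slab, `c₀(t) = c(t)` a.e.
    have hae : ∀ S : Set (EuclideanSpace ℝ (Fin 3)),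
        (fun z : ℝ × EuclideanSpace ℝ (Fin 3) => ‖π z.1 z.2 - c z.1‖ₑ ^ (3 / 2 : ℝ)) =ᵐ[volume.restrict (Ioo 0 T ×ˢ S)]
          fun z => ‖π z.1 z.2 - c₀ z.1‖ₑ ^ (3 / 2 : ℝ) := by
      intro S
      have h1 : (fun z : ℝ × EuclideanSpace ℝ (Fin 3) => c z.1) =ᵐ[volume.restrict (Ioo 0 T ×ˢ S)]
          fun z => c₀ z.1 := by
        rw [Measure.volume_eq_prod, ← Measure.prod_restrict]
        exact (Measure.quasiMeasurePreserving_fst (μ := volume.restrict (Ioo 0 T))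
          (ν := volume.restrict S)).ae_eq_comp hcc.symm
      filter_upwards [h1] with z hz
      rw [hz]
    -- `∫₀ᵀ |c|^{3/2} < ∞`
    have hcT : ∫⁻ t in Ioo 0 T, ‖c t‖ₑ ^ (3 / 2 : ℝ) < ∞ := by
      have hm := hcL.eLpNorm_lt_top
      rw [eLpNorm_lt_top_iff_lintegral_rpow_enorm_lt_top (by norm_num)
        (ENNReal.div_ne_top (by norm_num) (by norm_num))] at hm
      have e : ((3 / 2 : ℝ≥0∞)).toReal = (3 / 2 : ℝ) := by
        rw [ENNReal.toReal_div]; norm_num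
      rw [e] at hm
      exact hm
    -- finiteness of the renormalised pressure on every box `(0,T) × B(0,R')`
    have hfin : ∀ R' : ℝ, 0 < R' →
        ∫⁻ z in Ioo 0 T ×ˢ ball (0 : EuclideanSpace ℝ (Fin 3)) R', ‖π z.1 z.2 - c z.1‖ₑ ^ (3 / 2 : ℝ) < ∞ := by
      intro R' hR'
      have hp : ∫⁻ z in Ioo 0 T ×ˢ ball (0 : EuclideanSpace ℝ (Fin 3)) R', ‖π z.1 z.2‖ₑ ^ (3 / 2 : ℝ) < ∞ :=
        lt_of_le_of_lt (lintegral_mono_set (prod_mono le_rfl ball_subset_closedBall))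
          (hvL.pressure _ (isCompact_closedBall _ _))
      have hc2 : ∫⁻ z in Ioo 0 T ×ˢ ball (0 : EuclideanSpace ℝ (Fin 3)) R', ‖c z.1‖ₑ ^ (3 / 2 : ℝ) < ∞ := by
        rw [Measure.volume_eq_prod, ← Measure.prod_restrict, lintegral_prod _
          (by fun_prop : Measurable fun z : ℝ × EuclideanSpace ℝ (Fin 3) => ‖c z.1‖ₑ ^ (3 / 2 : ℝ)).aemeasurable]
        simp only [lintegral_const, Measure.restrict_apply_univ]
        rw [lintegral_mul_const _ (by fun_prop)]
        exact ENNReal.mul_lt_top hcT measure_ball_lt_top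
      have hpt : ∀ z : ℝ × EuclideanSpace ℝ (Fin 3), ‖π z.1 z.2 - c z.1‖ₑ ^ (3 / 2 : ℝ) ≤
          (2 : ℝ≥0∞) ^ ((3 / 2 : ℝ) - 1) * (‖π z.1 z.2‖ₑ ^ (3 / 2 : ℝ) + ‖c z.1‖ₑ ^ (3 / 2 : ℝ)) := by
        intro z
        have hsub : ‖π z.1 z.2 - c z.1‖ₑ ≤ ‖π z.1 z.2‖ₑ + ‖c z.1‖ₑ := enorm_sub_le
        exact (ENNReal.rpow_le_rpow hsub (by norm_num)).trans
          (ENNReal.rpow_add_le_mul_rpow_add_rpow _ _ (by norm_num : (1 : ℝ) ≤ 3 / 2))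
      calc ∫⁻ z in Ioo 0 T ×ˢ ball (0 : EuclideanSpace ℝ (Fin 3)) R', ‖π z.1 z.2 - c z.1‖ₑ ^ (3 / 2 : ℝ)
          ≤ ∫⁻ z in Ioo 0 T ×ˢ ball (0 : EuclideanSpace ℝ (Fin 3)) R', (2 : ℝ≥0∞) ^ ((3 / 2 : ℝ) - 1) *
              (‖π z.1 z.2‖ₑ ^ (3 / 2 : ℝ) + ‖c z.1‖ₑ ^ (3 / 2 : ℝ)) := lintegral_mono hpt
        _ ≤ (2 : ℝ≥0∞) ^ ((3 / 2 : ℝ) - 1) *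
              ((∫⁻ z in Ioo 0 T ×ˢ ball (0 : EuclideanSpace ℝ (Fin 3)) R', ‖π z.1 z.2‖ₑ ^ (3 / 2 : ℝ)) +
                ∫⁻ z in Ioo 0 T ×ˢ ball (0 : EuclideanSpace ℝ (Fin 3)) R', ‖c z.1‖ₑ ^ (3 / 2 : ℝ)) := by
            rw [← lintegral_add_right' _ ((by fun_prop : Measurable fun z : ℝ × EuclideanSpace ℝ (Fin 3) =>
              ‖c z.1‖ₑ ^ (3 / 2 : ℝ)).aemeasurable), ← lintegral_const_mul' _ _
              (ENNReal.rpow_ne_top_of_nonneg (by norm_num) ENNReal.ofNat_ne_top)]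
        _ < ∞ := ENNReal.mul_lt_top (ENNReal.rpow_lt_top_of_nonneg (by norm_num) ENNReal.ofNat_ne_top)
            (ENNReal.add_lt_top.2 ⟨hp, hc2⟩)
    refine ⟨c, hcm, hcL, hvL.sub_pressure hcm hcL hfin, ?_⟩
    rw [lintegral_congr_ae (hae (ball x₀ R))]
    exact hc₀b.trans hKle

/-! ### From an a.e. initial layer to an every-time one (weak continuity of Seregin's class) -/

/-- **The initial layer at every time from an a.e. layer with a monotone majorant** (weak lower
semicontinuity along good times `sₙ ↓ t`, the tree's
`IsLocalEnergySolutionOn.eLpNorm_sub_heatTest_le_of_ae`; Lemarié-Rieusset 2016, p. 571): if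
`‖v(s) − e^{sΔ}U₀‖_{L²(B(x₀,1))} ≤ g(s)` for a.e. `s ∈ (0, T')`, `T' ≤ T`, with `g` monotone, then
`‖v(t) − e^{tΔ}U₀‖_{L²(B(x₀,1))} ≤ g(2t)` for **every** `t ∈ (0, T')` (the good times in
`(t, min(2t, T'))` carry the bound `g(min(2t,T')) ≤ g(2t)`). [cite: LemarieRieusset2016, proof of Thm. 15.5, p. 571] -/
theorem IsLocalEnergySolutionOn.eLpNorm_sub_heatTest_le_of_ae_of_monotone {T : ℝ}
    {U₀ : EuclideanSpace ℝ (Fin 3) → EuclideanSpace ℝ (Fin 3)}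
    {V : ℝ → EuclideanSpace ℝ (Fin 3) → EuclideanSpace ℝ (Fin 3)}
    {Q : ℝ → EuclideanSpace ℝ (Fin 3) → ℝ}
    (h : IsLocalEnergySolutionOn T 1 U₀ V Q) (hU₀ : MemLp U₀ 3 volume) {M : ℝ}
    (hU₀M : eLpNorm U₀ 3 volume ≤ ENNReal.ofReal M) {T' : ℝ} (hT' : T' ≤ T)
    (x₀ : EuclideanSpace ℝ (Fin 3)) {g : ℝ → ℝ≥0} (hg : Monotone g)
    (hae : ∀ᵐ s ∂(volume.restrict (Ioo 0 T')),
      eLpNorm (V s - heatTest 1 U₀ s) 2 (volume.restrict (ball x₀ 1)) ≤ g s)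
    {t : ℝ} (ht : t ∈ Ioo 0 T') :
    eLpNorm (V t - heatTest 1 U₀ t) 2 (volume.restrict (ball x₀ 1)) ≤ g (2 * t) := by
  set c : ℝ := min (2 * t) T' with hc_def
  have htc : t < c := lt_min (by linarith [ht.1]) ht.2
  have hcT : c ≤ T := (min_le_right _ _).trans hT'
  have hc2 : c ≤ 2 * t := min_le_left _ _
  have hae' : ∀ᵐ s ∂(volume : Measure ℝ), s ∈ Ioo t c →
      eLpNorm (V s - heatTest 1 U₀ s) 2 (volume.restrict (ball x₀ 1)) ≤ g (2 * t) := by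
    have h1 := (ae_restrict_iff' (measurableSet_Ioo (a := (0 : ℝ)) (b := T'))).1 hae
    filter_upwards [h1] with s hs hst
    have hsI : s ∈ Ioo 0 T' := ⟨ht.1.trans hst.1, hst.2.trans_le (min_le_right _ _)⟩
    exact (hs hsI).trans (ENNReal.coe_le_coe.2 (hg (hst.2.le.trans hc2)))
  exact h.eLpNorm_sub_heatTest_le_of_ae hU₀ hU₀M ht.1 htc hcT x₀ hae'

/-- `g(2t) → 0` as `t → 0⁺` when `g(t) → 0`. [folklore] -/
theorem tendsto_comp_two_mul_nhdsGT_zero {g : ℝ → ℝ≥0} (hg : Tendsto g (𝓝[>] 0) (𝓝 0)) :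
    Tendsto (fun t => g (2 * t)) (𝓝[>] 0) (𝓝 0) := by
  refine hg.comp ?_
  refine tendsto_nhdsWithin_of_tendsto_nhds_of_eventually_within _ ?_ ?_
  · have hc : Continuous fun t : ℝ => 2 * t := continuous_const.mul continuous_id
    have := (hc.tendsto (0 : ℝ)).mono_left (nhdsWithin_le_nhds (s := Ioi (0 : ℝ)))
    simpa using this
  · filter_upwards [self_mem_nhdsWithin] with t ht
    exact mul_pos two_pos (mem_Ioi.1 ht)

/-- **The every-time layer package of `seregin_L3_blowup_of_layer` from an a.e. layer with
monotone majorants** (bookkeeping: `IsLocalEnergySolutionOn.eLpNorm_sub_heatTest_le_of_ae_of_monotone`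
with `η(t) = g(2t)`). [folklore] -/
theorem slabLayer_of_ae_monotone
    (h : ∀ M : ℝ≥0, ∃ S₁ : ℝ, 0 < S₁ ∧ ∀ T : ℝ, 0 < T → T ≤ S₁ →
      ∃ g : ℝ → ℝ≥0, Monotone g ∧ Tendsto g (𝓝[>] 0) (𝓝 0) ∧
      ∀ (a : EuclideanSpace ℝ (Fin 3) → EuclideanSpace ℝ (Fin 3))
        (v : ℝ → EuclideanSpace ℝ (Fin 3) → EuclideanSpace ℝ (Fin 3))
        (π : ℝ → EuclideanSpace ℝ (Fin 3) → ℝ),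
        MemLp a 3 volume → eLpNorm a 3 volume ≤ M → IsLocalEnergySolutionOn T 1 a v π →
        ∀ x₀ : EuclideanSpace ℝ (Fin 3), ∀ᵐ t ∂(volume.restrict (Ioo 0 T)),
          eLpNorm (v t - heatTest 1 a t) 2 (volume.restrict (ball x₀ 1)) ≤ g t) :
    ∀ M : ℝ≥0, ∃ S₁ : ℝ, 0 < S₁ ∧ ∀ T : ℝ, 0 < T → T ≤ S₁ →
      ∃ η : ℝ → ℝ≥0, Tendsto η (𝓝[>] 0) (𝓝 0) ∧
      ∀ (a : EuclideanSpace ℝ (Fin 3) → EuclideanSpace ℝ (Fin 3))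
        (v : ℝ → EuclideanSpace ℝ (Fin 3) → EuclideanSpace ℝ (Fin 3))
        (π : ℝ → EuclideanSpace ℝ (Fin 3) → ℝ),
        MemLp a 3 volume → eLpNorm a 3 volume ≤ M → IsLocalEnergySolutionOn T 1 a v π →
        ∀ t ∈ Ioo 0 T, ∀ x₀ : EuclideanSpace ℝ (Fin 3),
          eLpNorm (v t - heatTest 1 a t) 2 (volume.restrict (ball x₀ 1)) ≤ η t := by
  intro M
  obtain ⟨S₁, hS₁, hT⟩ := h M
  refine ⟨S₁, hS₁, fun T hT0 hTS => ?_⟩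
  obtain ⟨g, hg, hg0, hlay⟩ := hT T hT0 hTS
  refine ⟨fun t => g (2 * t), tendsto_comp_two_mul_nhdsGT_zero hg0, fun a v π ha haM hv t ht x₀ => ?_⟩
  have haM' : eLpNorm a 3 volume ≤ ENNReal.ofReal (M : ℝ) := by
    rw [ENNReal.ofReal_coe_nnreal]; exact haM
  exact hv.eLpNorm_sub_heatTest_le_of_ae_of_monotone ha haM' le_rfl x₀ hg (hlay a v π ha haM hv x₀) ht

/-! ### From a layer estimate on strips of a fixed length to short strips (Seregin's scaling) -/

/-- **Covariance of the initial layer under the Navier–Stokes scaling.** For `κ > 0`, `s > 0`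
and any fields `v(t), a` on `ℝ³`: with `t = κ² s`,
`∫_{B(κ z, κ)} |v(t) − e^{tΔ}a|² = κ ∫_{B(z,1)} |κ v(t)(κ·) − e^{sΔ}(κ a(κ·))|²`
(`e^{sΔ}(κ a(κ·)) = κ (e^{κ²sΔ}a)(κ·)`, `heatExtension_nsRescaleData`, and `dy = κ⁻³ dx`).
[folklore] -/
theorem lintegral_ball_layer_rescale (v : ℝ → EuclideanSpace ℝ (Fin 3) → EuclideanSpace ℝ (Fin 3))
    (a : EuclideanSpace ℝ (Fin 3) → EuclideanSpace ℝ (Fin 3)) {κ s : ℝ} (hκ : 0 < κ) (hs : 0 < s)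
    (z : EuclideanSpace ℝ (Fin 3)) :
    ∫⁻ x in ball (κ • z) κ, ‖v (κ ^ 2 * s) x - heatTest 1 a (κ ^ 2 * s) x‖ₑ ^ 2 =
      ENNReal.ofReal κ * ∫⁻ y in ball z 1,
        ‖κ • v (κ ^ 2 * s) (κ • y) - heatTest 1 (nsRescaleData κ a) s y‖ₑ ^ 2 := by
  -- the caloric parts correspond under the scaling
  have hheat : ∀ y : EuclideanSpace ℝ (Fin 3), heatTest 1 (nsRescaleData κ a) s y =
      κ • heatTest 1 a (κ ^ 2 * s) (κ • y) := by
    intro y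
    simp only [heatTest, one_mul]
    rw [heatFlow_of_pos _ hs, heatFlow_of_pos _ (by positivity), BradshawTsai2017.heatExtension_nsRescaleData hκ a hs]
  have hpt : ∀ y : EuclideanSpace ℝ (Fin 3),
      ‖κ • v (κ ^ 2 * s) (κ • y) - heatTest 1 (nsRescaleData κ a) s y‖ₑ ^ 2 =
        ENNReal.ofReal (κ ^ 2) * ‖v (κ ^ 2 * s) (κ • y) - heatTest 1 a (κ ^ 2 * s) (κ • y)‖ₑ ^ 2 := by
    intro y
    rw [hheat y, ← smul_sub, enorm_smul, mul_pow, Real.enorm_eq_ofReal hκ.le,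
      ← ENNReal.ofReal_pow hκ.le]
  simp_rw [hpt]
  rw [lintegral_const_mul' _ _ ENNReal.ofReal_ne_top,
    setLIntegral_ball_center_comp_smul (fun x => ‖v (κ ^ 2 * s) x - heatTest 1 a (κ ^ 2 * s) x‖ₑ ^ 2)
      hκ z 1, mul_one, finrank_euclideanSpace_fin, ← mul_assoc, ← mul_assoc,
    ← ENNReal.ofReal_mul hκ.le, ← ENNReal.ofReal_mul (by positivity)]
  rw [show κ * κ ^ 2 * (κ ^ 3)⁻¹ = 1 by field_simp, ENNReal.ofReal_one, one_mul]

/-- **A unit ball is covered by boundedly many balls of radius `κ ≤ 1`, uniformly in the centre**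
(a finite unit-ball cover of `B(0, 1/κ)`, scaled). [folklore] -/
theorem exists_finset_ball_one_subset_biUnion_ball {κ : ℝ} (hκ : 0 < κ) :
    ∃ F : Finset (EuclideanSpace ℝ (Fin 3)), ∀ x₀ : EuclideanSpace ℝ (Fin 3),
      ball x₀ 1 ⊆ ⋃ c ∈ F, ball (κ • (κ⁻¹ • x₀ + c)) κ := by
  obtain ⟨F, hF⟩ := exists_finset_ball_subset_biUnion_ball_one (1 / κ)
  refine ⟨F, fun x₀ y hy => ?_⟩
  have hy' : κ⁻¹ • y ∈ ball (κ⁻¹ • x₀) (1 / κ) := by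
    rw [mem_ball, dist_smul₀, norm_inv, Real.norm_eq_abs, abs_of_pos hκ, one_div]
    exact (mul_lt_iff_lt_one_right (inv_pos.2 hκ)).2 (mem_ball.1 hy)
  obtain ⟨c, hc, hyc⟩ := mem_iUnion₂.1 (hF (κ⁻¹ • x₀) hy')
  refine mem_iUnion₂.2 ⟨c, hc, ?_⟩
  rw [mem_ball] at hyc ⊢
  have e : y = κ • (κ⁻¹ • y) := by rw [smul_smul, mul_inv_cancel₀ hκ.ne', one_smul]
  rw [e, dist_smul₀, Real.norm_eq_abs, abs_of_pos hκ]
  calc κ * dist (κ⁻¹ • y) (κ⁻¹ • x₀ + c) < κ * 1 := mul_lt_mul_of_pos_left hyc hκ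
    _ = κ := mul_one κ

/-- **From a uniform initial layer on strips of a fixed length `L` (with unit-ball a priori inputs)
to the short-strip layer package of `seregin_L3_blowup_of_layer`** (Seregin 2012, §2: the
estimates are applied to the *rescaled* solutions `u^{(k)}` living on the fixed strip `]−S, 0[`;
the Navier–Stokes scaling `v ↦ κ v(κ² ·, κ ·)`, `κ = √(T/L)`, maps a local energy solution on
`(0, T)` with `L³` datum of norm `≤ M` to one on `(0, L)` with the same `L³` bound, unit-ball
energies and dissipations scaling by `κ⁻¹` (`IsLocalEnergySolutionOn.stRescale`,
`exists_localEnergy_bounds_of_L3_data`), and the layer on a unit ball of the original is recovered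
from the layers of the rescaled solution on the unit balls of a bounded cover of `B(x₀, 1)` by balls
of radius `κ`, `lintegral_ball_layer_rescale`). The hypothesis `h` is the length-`L` layer: for all
`M, A` a monotone majorant `g → 0` valid a.e. in time for every local energy solution on `(0, L)`
with unit viscosity, `L³` datum of norm `≤ M`, every-time unit-ball energies `≤ A` on `[0, L)` and
unit-cylinder dissipation `≤ A` for every weak spatial gradient.
[cite: Seregin2012CMP, §2 (2.3)–(2.4), (2.12)–(2.13)] -/
theorem slabLayer_of_layer_at_length {L : ℝ} (hL : 0 < L)
    (h : ∀ M A : ℝ≥0, ∃ g : ℝ → ℝ≥0, Monotone g ∧ Tendsto g (𝓝[>] 0) (𝓝 0) ∧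
      ∀ (a : EuclideanSpace ℝ (Fin 3) → EuclideanSpace ℝ (Fin 3))
        (v : ℝ → EuclideanSpace ℝ (Fin 3) → EuclideanSpace ℝ (Fin 3))
        (π : ℝ → EuclideanSpace ℝ (Fin 3) → ℝ),
        MemLp a 3 volume → eLpNorm a 3 volume ≤ M → IsLocalEnergySolutionOn L 1 a v π →
        (∀ s ∈ Ico 0 L, ∀ y₀ : EuclideanSpace ℝ (Fin 3), ∫⁻ y in ball y₀ 1, ‖v s y‖ₑ ^ 2 ≤ A) →
        (∀ G : ℝ → EuclideanSpace ℝ (Fin 3) → EuclideanSpace ℝ (Fin 3) →L[ℝ] EuclideanSpace ℝ (Fin 3),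
          HasWeakSpatialGradientOn (slab (EuclideanSpace ℝ (Fin 3)) (Ioo 0 L) isOpen_Ioo) v G →
          ∀ y₀ : EuclideanSpace ℝ (Fin 3),
            ∫⁻ z in Ioo 0 L ×ˢ ball y₀ 1, ENNReal.ofReal (frobeniusNormSq (G z.1 z.2)) ≤ A) →
        ∀ y₀ : EuclideanSpace ℝ (Fin 3), ∀ᵐ s ∂(volume.restrict (Ioo 0 L)),
          eLpNorm (v s - heatTest 1 a s) 2 (volume.restrict (ball y₀ 1)) ≤ g s) :
    ∀ M : ℝ≥0, ∃ S₁ : ℝ, 0 < S₁ ∧ ∀ T : ℝ, 0 < T → T ≤ S₁ →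
      ∃ η : ℝ → ℝ≥0, Tendsto η (𝓝[>] 0) (𝓝 0) ∧
      ∀ (a : EuclideanSpace ℝ (Fin 3) → EuclideanSpace ℝ (Fin 3))
        (v : ℝ → EuclideanSpace ℝ (Fin 3) → EuclideanSpace ℝ (Fin 3))
        (π : ℝ → EuclideanSpace ℝ (Fin 3) → ℝ),
        MemLp a 3 volume → eLpNorm a 3 volume ≤ M → IsLocalEnergySolutionOn T 1 a v π →
        ∀ t ∈ Ioo 0 T, ∀ x₀ : EuclideanSpace ℝ (Fin 3),
          eLpNorm (v t - heatTest 1 a t) 2 (volume.restrict (ball x₀ 1)) ≤ η t := by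
  intro M
  obtain ⟨S₀, B, hS₀, hS₀1, hbounds⟩ := exists_localEnergy_bounds_of_L3_data
  refine ⟨min (S₀ M) L, lt_min (hS₀ M) hL, fun T hT hTS => ?_⟩
  have hTS₀ : T ≤ S₀ M := hTS.trans (min_le_left _ _)
  have hTL : T ≤ L := hTS.trans (min_le_right _ _)
  -- ### the scale `κ = √(T/L) ∈ (0, 1]`
  set κ : ℝ := Real.sqrt (T / L) with hκ_def
  have hκ : 0 < κ := Real.sqrt_pos.2 (by positivity)
  have hκ2 : κ ^ 2 = T / L := Real.sq_sqrt (by positivity)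
  have hκ1 : κ ≤ 1 := by
    rw [hκ_def, Real.sqrt_le_one]
    exact (div_le_one hL).2 hTL
  have hTκ : T / κ ^ 2 = L := by rw [hκ2]; field_simp
  have hκT : κ ^ 2 * L = T := by rw [hκ2]; field_simp
  -- ### the length-`L` layer for the bound `A = κ⁻¹ B(M)`
  set A : ℝ≥0 := (κ⁻¹).toNNReal * B M with hA_def
  have hAcoe : (A : ℝ≥0∞) = ENNReal.ofReal κ⁻¹ * B M := by rw [hA_def, ENNReal.coe_mul, ENNReal.ofReal]
  obtain ⟨g, hg, hg0, hlay⟩ := h M A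
  -- ### the cover of unit balls by balls of radius `κ`
  obtain ⟨F, hF⟩ := exists_finset_ball_one_subset_biUnion_ball hκ
  refine ⟨fun t => (F.card : ℝ≥0) * g (2 * (t / κ ^ 2)), ?_, fun a v π ha haM hv t ht x₀ => ?_⟩
  · -- `η → 0`
    have h1 : Tendsto (fun t : ℝ => t / κ ^ 2) (𝓝[>] 0) (𝓝[>] 0) := by
      refine tendsto_nhdsWithin_of_tendsto_nhds_of_eventually_within _ ?_ ?_
      · have hc : Continuous fun t : ℝ => t / κ ^ 2 := continuous_id.div_const _
        have := (hc.tendsto (0 : ℝ)).mono_left (nhdsWithin_le_nhds (s := Ioi (0 : ℝ)))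
        simpa using this
      · filter_upwards [self_mem_nhdsWithin] with t ht
        exact div_pos (mem_Ioi.1 ht) (by positivity)
    have h2 := (tendsto_comp_two_mul_nhdsGT_zero hg0).comp h1
    have h3 := h2.const_mul (F.card : ℝ≥0)
    rw [mul_zero] at h3
    exact h3
  -- ### the rescaled solution on `(0, L)`
  obtain ⟨hE, hIco, G₀, hG₀, hG₀b⟩ := hbounds M T a v π hT hTS₀ ha haM hv
  have hV := hv.stRescale (α := κ) (β := κ ^ 2) (γ := κ) hκ hκ (by ring) 0
  have e1 : κ * 1 / κ = 1 := by field_simp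
  have e2 : (fun y : EuclideanSpace ℝ (Fin 3) => κ • a (0 + κ • y)) = nsRescaleData κ a := by
    funext y; rw [zero_add]; rfl
  have e3 : (κ • stPull (κ ^ 2) κ 0 0 v) = fun s y => κ • v (κ ^ 2 * s) (κ • y) := by
    funext s y; rw [smul_stPull_apply, zero_add, zero_add]
  rw [hTκ, e1, e2, e3] at hV
  set V : ℝ → EuclideanSpace ℝ (Fin 3) → EuclideanSpace ℝ (Fin 3) :=
    fun s y => κ • v (κ ^ 2 * s) (κ • y) with hV_def
  -- the rescaled datum: same `L³` norm
  have hA3 : MemLp (nsRescaleData κ a) 3 volume := memLp_three_rescaleData ha hκ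
  have hAM : eLpNorm (nsRescaleData κ a) 3 volume ≤ M := by
    rw [show nsRescaleData κ a = rescaleData κ a from rfl, eLpNorm_three_rescaleData a hκ]
    exact haM
  -- ### unit-ball energies of `V`: `κ⁻¹`-times the radius-`κ` energies of `v`
  have hVE : ∀ s ∈ Ico 0 L, ∀ y₀ : EuclideanSpace ℝ (Fin 3),
      ∫⁻ y in ball y₀ 1, ‖V s y‖ₑ ^ 2 ≤ A := by
    intro s hs y₀
    have hsT : κ ^ 2 * s ∈ Ico 0 T := by
      refine ⟨by have := hs.1; positivity, ?_⟩
      calc κ ^ 2 * s < κ ^ 2 * L := mul_lt_mul_of_pos_left hs.2 (by positivity)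
        _ = T := hκT
    have hpt : ∀ y : EuclideanSpace ℝ (Fin 3), ‖V s y‖ₑ ^ 2 =
        ENNReal.ofReal (κ ^ 2) * ‖v (κ ^ 2 * s) (κ • y)‖ₑ ^ 2 := by
      intro y
      show ‖κ • v (κ ^ 2 * s) (κ • y)‖ₑ ^ 2 = _
      rw [enorm_smul, mul_pow, Real.enorm_eq_ofReal hκ.le, ← ENNReal.ofReal_pow hκ.le]
    simp_rw [hpt]
    rw [lintegral_const_mul' _ _ ENNReal.ofReal_ne_top,
      setLIntegral_ball_center_comp_smul (fun x => ‖v (κ ^ 2 * s) x‖ₑ ^ 2) hκ y₀ 1, mul_one,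
      finrank_euclideanSpace_fin, ← mul_assoc, ← ENNReal.ofReal_mul (by positivity),
      show κ ^ 2 * (κ ^ 3)⁻¹ = κ⁻¹ by field_simp, hAcoe]
    gcongr
    exact (lintegral_mono_set (ball_subset_ball (by simpa using hκ1))).trans (hIco _ hsT (κ • y₀))
  -- ### unit-cylinder dissipation of `V`, for every weak gradient
  have hVG : ∀ G : ℝ → EuclideanSpace ℝ (Fin 3) → EuclideanSpace ℝ (Fin 3) →L[ℝ] EuclideanSpace ℝ (Fin 3),
      HasWeakSpatialGradientOn (slab (EuclideanSpace ℝ (Fin 3)) (Ioo 0 L) isOpen_Ioo) V G →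
      ∀ y₀ : EuclideanSpace ℝ (Fin 3),
        ∫⁻ z in Ioo 0 L ×ˢ ball y₀ 1, ENNReal.ofReal (frobeniusNormSq (G z.1 z.2)) ≤ A := by
    intro G hG y₀
    -- the rescaled class gradient
    have hG₁ := hG₀.stRescale κ (β := κ ^ 2) (γ := κ) (by positivity) hκ 0 0
    rw [stPreimage_zero_slab_Ioo (by positivity), hTκ, e3] at hG₁
    have hae : ∀ᵐ z ∂(volume.restrict (Ioo 0 L ×ˢ ball y₀ 1)),
        ENNReal.ofReal (frobeniusNormSq (G z.1 z.2)) =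
          ENNReal.ofReal (frobeniusNormSq (((κ * κ) • stPull (κ ^ 2) κ 0 0 G₀) z.1 z.2)) := by
      have h1 := hG.ae_eq hG₁
      have hsub : Ioo 0 L ×ˢ ball y₀ 1 ⊆ ((slab (EuclideanSpace ℝ (Fin 3)) (Ioo 0 L) isOpen_Ioo :
          Opens (ℝ × EuclideanSpace ℝ (Fin 3))) : Set (ℝ × EuclideanSpace ℝ (Fin 3))) :=
        fun z hz => mem_slab.2 hz.1
      filter_upwards [ae_restrict_of_ae_restrict_of_subset hsub h1] with z hz
      have hz' : G z.1 z.2 = ((κ * κ) • stPull (κ ^ 2) κ 0 0 G₀) z.1 z.2 := hz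
      rw [hz']
    rw [lintegral_congr_ae hae]
    -- the box `(0, L) × B(y₀, 1)` is the preimage of `(0, T) × B(κ y₀, κ)`
    have hpre : stAffine (κ ^ 2) κ 0 0 ⁻¹' (Ioo 0 T ×ˢ ball (κ • y₀) κ) = Ioo 0 L ×ˢ ball y₀ 1 := by
      rw [stAffine_preimage_cylinder (by positivity) hκ]
      congr 2
      · simp
      · rw [sub_zero, hTκ]
      · rw [sub_zero, smul_smul, inv_mul_cancel₀ hκ.ne', one_smul]
      · field_simp
    rw [← hpre, setLIntegral_frobeniusNormSq_stRescale (by positivity) hκ 0 0 (κ * κ) G₀,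
      finrank_euclideanSpace_fin, ← ENNReal.ofReal_mul (by positivity),
      show (κ * κ) ^ 2 * (κ ^ 2 * κ ^ 3)⁻¹ = κ⁻¹ by field_simp, hAcoe]
    gcongr
    exact (lintegral_mono_set (Set.prod_mono le_rfl (ball_subset_ball (by simpa using hκ1)))).trans
      (hG₀b (κ • y₀))
  -- ### the layer of `V`: a.e., then at every time (monotone majorant)
  have hlayV : ∀ y₀ : EuclideanSpace ℝ (Fin 3), ∀ s ∈ Ioo 0 L,
      eLpNorm (V s - heatTest 1 (nsRescaleData κ a) s) 2 (volume.restrict (ball y₀ 1)) ≤ g (2 * s) := by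
    intro y₀ s hs
    have hAM' : eLpNorm (nsRescaleData κ a) 3 volume ≤ ENNReal.ofReal (M : ℝ) := by
      rw [ENNReal.ofReal_coe_nnreal]; exact hAM
    exact hV.eLpNorm_sub_heatTest_le_of_ae_of_monotone hA3 hAM' le_rfl y₀ hg
      (hlay _ V _ hA3 hAM hV hVE hVG y₀) hs
  -- ### back to `v` at the time `t = κ² s`
  set s : ℝ := t / κ ^ 2 with hs_def
  have hs0 : 0 < s := div_pos ht.1 (by positivity)
  have hsL : s < L := by
    rw [hs_def, div_lt_iff₀ (by positivity), mul_comm, hκT]; exact ht.2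
  have hts : κ ^ 2 * s = t := by rw [hs_def]; field_simp
  -- each ball of radius `κ` of the cover carries `κ g(2s)²`
  have hpiece : ∀ c : EuclideanSpace ℝ (Fin 3),
      ∫⁻ x in ball (κ • (κ⁻¹ • x₀ + c)) κ, ‖v t x - heatTest 1 a t x‖ₑ ^ 2 ≤
        ENNReal.ofReal κ * (g (2 * s) : ℝ≥0∞) ^ 2 := by
    intro c
    rw [← hts, lintegral_ball_layer_rescale v a hκ hs0]
    gcongr
    rw [lintegral_enorm_sq_eq_eLpNorm_two_pow]
    exact pow_le_pow_left' (hlayV _ s ⟨hs0, hsL⟩) 2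
  -- sum over the cover
  have hsum : ∫⁻ x in ball x₀ 1, ‖v t x - heatTest 1 a t x‖ₑ ^ 2 ≤
      F.card * (ENNReal.ofReal κ * (g (2 * s) : ℝ≥0∞) ^ 2) :=
    (lintegral_mono_set (hF x₀)).trans
      (lintegral_biUnion_finset_le_card_mul F _ _ fun c _ => hpiece c)
  -- `‖·‖₂ ≤ card F · g(2s)` since `κ ≤ 1` and `card F ≤ (card F)²`
  have hcard : (F.card : ℝ≥0∞) ≤ (F.card : ℝ≥0∞) ^ 2 := by
    rcases Nat.eq_zero_or_pos F.card with h0 | hpos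
    · rw [h0]; simp
    · calc (F.card : ℝ≥0∞) = (F.card : ℝ≥0∞) ^ 1 := (pow_one _).symm
        _ ≤ (F.card : ℝ≥0∞) ^ 2 := pow_le_pow_right₀ (by exact_mod_cast hpos) one_le_two
  have hsq : eLpNorm (v t - heatTest 1 a t) 2 (volume.restrict (ball x₀ 1)) ^ 2 ≤
      ((F.card : ℝ≥0∞) * (g (2 * s) : ℝ≥0∞)) ^ 2 := by
    rw [← lintegral_enorm_sq_eq_eLpNorm_two_pow]
    refine (le_of_eq ?_).trans (hsum.trans ?_)
    · rfl
    · rw [mul_pow]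
      calc (F.card : ℝ≥0∞) * (ENNReal.ofReal κ * (g (2 * s) : ℝ≥0∞) ^ 2)
          ≤ (F.card : ℝ≥0∞) * (1 * (g (2 * s) : ℝ≥0∞) ^ 2) := by
            gcongr
            exact ENNReal.ofReal_le_one.2 hκ1
        _ = (F.card : ℝ≥0∞) * (g (2 * s) : ℝ≥0∞) ^ 2 := by rw [one_mul]
        _ ≤ (F.card : ℝ≥0∞) ^ 2 * (g (2 * s) : ℝ≥0∞) ^ 2 := by gcongr
  have hroot := ENNReal.rpow_le_rpow (z := ((2 : ℕ) : ℝ)⁻¹) hsq (by positivity)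
  rw [ENNReal.pow_rpow_inv_natCast two_ne_zero, ENNReal.pow_rpow_inv_natCast two_ne_zero] at hroot
  refine hroot.trans (le_of_eq ?_)
  push_cast
  rfl

end Literature.Analysis.FluidPDE

end
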